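import Summits.HodgeConjecture.HodgeConjecture.Theorems.Ring2HypothesesAtlasSixfoldsAnchors
import Summits.HodgeConjecture.HodgeConjecture.Theorems.Ring2ClassTargetsRowsSixSevenWeilPullbacks
import HarnessLib
import Summits.HodgeConjecture.HodgeConjecture.Theorems.Ring2HypothesesMultiWeilVsPullbacks

/-!
# Ring 2, hypotheses layer XVII — (G) `IsDivisorMultiWeilGenerated` versus the census X2 / X2′ ∧ X1 on rows `6, 7`

HONEST FRAMING: research route conditional on HC_CM; not a corollary; Q11.4-sentence-2 already refuted in
dim ≥ 3. `HC_CM` = `Theses.RankFourFaces.CMAbelianHodge` (stmt-HodgeConjecture-3052) is an ARGUMENT wherever it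
occurs (§5 only), never a fact.

LEAD L7.5 (b) (carried from L6.5 (5)): "`IsDivisorMultiWeilGenerated` / `allWeilClasses` (part XIV) vs X2′ ∧ X1
on dims 6, 7 — the implication you can prove or the obstruction, by name." Answered here in the kernel. Players,
all typed elsewhere and used BY NAME, none asserted: (G) `IsDivisorMultiWeilGenerated A` (part XIV §2): `B•(A) ⊗ ℂ
⊆ D•(A) ⊗ ℂ + Σ_k W_k ⊗ ℂ`, summed over ALL Weil structures of `A` ITSELF (`allWeilClasses A p`, zero unless
`2p = dim A`); X2 = `Theses.SevenfoldWeilCensus.CodimTwoFromLowerDim` (stmt-18721; refuted AT EVIDENCE LEVEL on the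
item, not in the kernel); X2′ = typer 1's re-target `Ring2.ClassTargets.CodimTwoFromWeilPullbacks` (X2's right-hand
side plus André's Weil pull-backs from any dimension); X1 = `Theses.SevenfoldWeilCensus.CodimThreeWeilGeneration`
(stmt-18720); their restrictions off a class `𝒞` (`CodimTwoFromWeilPullbacksOff`, `CodimThreeWeilGenerationOff`,
`WeilSixfoldsOff`, typer 1). PROVED (0 sorry, no new definition, no new named fact):
§1 `allWeilClasses A p = ⊥` off the middle degree, so (G) puts every off-middle Hodge class in `D•`; the sum of ALL
   Weil planes of type `(3, ·)` lies in X1's Weil-pull-back summand and of type `(2, ·)` in X2′'s André summand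
   (pull back along `𝟙 A.X`; a Weil plane is the span of its RATIONAL classes — van Geemen 4.9, tree theorem
   `weilClassesOf_eq_span_isRationalClass`).
§2 THE IMPLICATION, member by member: (G)(A) ⟹ the X1-clause and the X2′-clause of `A` in EVERY dimension, and the
   X2-clause of `A` — indeed `B²(A) ⊗ ℂ ⊆ D²(A) ⊗ ℂ` — whenever `dim A ≠ 4`; hence BY NAME "(G) on all 6- or
   7-folds ⟹ X2 ∧ X2′ ∧ X1" and the same OFF any class `𝒞`.
§3 THE ROWS from (G) off `𝒞`: through typer 1's `hcUpToDim_seven_of_censusOff` (HC on `𝒞`, (G) off `𝒞` on rows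
   `6, 7`, `W₆` off `𝒞`, floor ⟹ `HCUpToDim 7`) — the PRICE of X2′ (`CodimTwoWeilClassesCMFieldOff`, Weil classes
   of CM-FIELD type from dimension `≥ 8`) is NOT paid under (G), which yields X2 itself; and sharper, WITHOUT the
   floor or any lower-dimensional input: row `7` off `𝒞` from (G) ALONE (odd dimension: (G) is `B = D`, part XIV-B
   (A4′), then van Geemen §2.4 `hodgeConjectureFor_of_isDivisorGenerated`), row `6` off `𝒞` from (G) and the Weil
   classes of the member's OWN Weil structures; exactness `HCAtDim 6 ↔ W₆ (off 𝒞)` modulo {HC on `𝒞`, (G) off `𝒞`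
   in dimension `6`}.
§4 THE OBSTRUCTION to the converse and to (G) as a ROW hypothesis, by name: ONE rational `(p,p)` class with
   `2p ≠ dim A` outside `Dᵖ ⊗ ℂ` kills (G)(A); on a 6- or 7-fold every failure of the X2-clause is a failure of
   (G), so `¬ X2 ⟹ ¬ (G on all 6- or 7-folds)`: universal (G) INHERITS X2's evidence-level refutation. Recorded
   witnesses (pointers only, nothing asserted): (i) `X × T`, `X` an abelian FOURFOLD of Moonen–Zarhin's cases
   (a)–(c) ("in these cases `D²(X) ≠ B²(X)`", the remark after Thm. 0.1 = arXiv:math/9901113 p. 1), `T` of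
   dimension `2, 3`: CONFORMS to X2 (pull-backs from dimension `4 < dim A`), hence to X2′, VIOLATES (G) — so
   `X2 ∧ X1 ⇏ (G)` already there (granted X1 on it); (ii) the K3-partner sixfolds `Y × Z` of atlas-2's cell
   `Ring2.Atlas.HodgeQuarticTypeIVFourfoldTimesCMSurface` and the CM products `B × E′ × E″` of the X2 evidence
   (hodge-weil jobs j038435, j038496): VIOLATE X2 and (G), CONFORM to X2′ (André 1992 on the CM locus; the cell's
   certified computation `K3-WEIL-PULLBACK.md` off it); (iii) dimension `7`: `E × Y₆` and the power cells
   (Moonen–Zarhin (3.8)): (G) `= (B = D)` fails. So (G) is the MEMBER hypothesis of the Weil cells (part XIV §4;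
   Moonen–Zarhin §5 / van Geemen Thm. 6.12 as cell inference), never a row hypothesis. NOT proved (open): for a
   SIMPLE sixfold `X2 ∧ X1 ⟹ (G)` — needs isogeny transport of Weil planes, not in the tree.
§5 `𝒞 = IsOfCMType ∪ 𝒦` under `HC_CM` (binder, via `hcOnClass_cmType_of_hcCM` only) and a granted cell `𝒦` — by
   §4 (ii) "(G) off CM" alone is violated by the NON-CM K3 partners, so `𝒦` must contain them.
§6 Audit: the HC-shaped conclusions are on path; (G), X1, X2, X2′ are Hodge-theoretic generation statements, NOT
   consequences of HC, never asserted.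

References: [MoonenZarhin1999LowDim] Math. Ann. 315 (1999) = arXiv:math/9901113: Thm. 0.1 and the remark after it
(p. 1), Thm. 0.2 (e), (f), (2.7)–(2.8), (3.8), §5; [vanGeemen1994HodgeAV] LNM 1594: §2.4, 4.9–4.13, Lemma 5.2,
Thm. 6.12; [Andre1992HodgeCM] Progr. Math. 102 (1992), Théorème; [Deligne1982HodgeCycles] LNM 900, §4 Prop. 4.4,
Thm. 4.8; [Milne1999] Compositio 117, §7; [Markman2025SecantWeil] arXiv:2502.03415 Thm. 1.5.1 (UNREFEREED);
[Abdulali1994FamiliesAV] Canad. J. Math. 46, Lemma 6.2; [Deligne2000] Clay, §1.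
-/

set_option linter.dupNamespace false

noncomputable section

open CategoryTheory
open Literature.AlgebraicGeometry Literature.AlgebraicGeometry.Motives
open Literature.AlgebraicGeometry.HodgeTheory
open Literature.AlgebraicTopology.SingularHomology
open Literature.AlgebraicGeometry.Milne1999 (IsOfCMType)
open Literature.Barriers.HodgeConjecture (divisorClassesSpan)
open Summit.HodgeConjecture.HodgeConjecture.Theses
open Summit.HodgeConjecture.HodgeConjecture.Ring2.ClassTargets

namespace Summit.HodgeConjecture.HodgeConjecture.Ring2.Hypotheses

/-! ## §1 `allWeilClasses` off the middle degree, and inside X1's / X2′'s pull-back summands -/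

/-- **No Weil structure of type `(p, ·)` unless `dim A = 2p`**: off the middle degree the sum of all Weil planes
is `0` (generalises part XIV-B (A4) `allWeilClasses_eq_bot_of_odd_dim`). [cite: vanGeemen1994HodgeAV, 4.9] -/
theorem allWeilClasses_eq_bot_of_dim_ne {A : AbelianVariety ℂ} {p : ℕ} (h : A.dim ≠ 2 * p) :
    allWeilClasses A p = ⊥ := by
  rw [allWeilClasses, iSup_eq_bot]
  rintro ⟨w, hw⟩
  exact absurd hw.dim_eq h

-- (G) off the middle degree is `Bᵖ ⊗ ℂ ⊆ Dᵖ ⊗ ℂ`: landed in part XIX as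
-- `mem_divisorClassesSpan_of_isDivisorMultiWeilGenerated_off_middle` (imported, reused below).

/-- **Every Weil plane of type `(3, d)` of `A` lies in X1's Weil-pull-back summand** (pull back along `𝟙 A.X`
from the sixfold `B = A`): the plane is the `ℂ`-span of its RATIONAL classes (van Geemen 4.9, tree theorem
`weilClassesOf_eq_span_isRationalClass`), each of Hodge type `(3,3)` (van Geemen 4.10 / Deligne–Milne Prop. 4.4,
`IsWeilType.isOfHodgeType_of_mem_weilClassesOf`). [cite: vanGeemen1994HodgeAV, 4.9–4.10]
[cite: Deligne1982HodgeCycles, §4 Prop. 4.4] -/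
theorem weilClassesOf_three_le_span_weilPullbacks {A : AbelianVariety ℂ} {φ : A ⟶ A} {d : ℕ}
    (hw : IsWeilType A φ 3 d) :
    weilClassesOf A φ 3 d ≤ Submodule.span ℂ {w' : complexBetti A.X (2 * 3) |
      ∃ (B : AbelianVariety ℂ) (g : A.X ⟶ B.X) (d : ℕ) (ψ : B ⟶ B) (w : complexBetti B.X (2 * 3)),
        B.dim = 6 ∧ 0 < d ∧ ψ ≫ ψ = -(d • 𝟙 B) ∧ IsRationalClass w ∧
        IsOfHodgeType B.dim B.X (2 * 3) 3 3 w ∧ w ∈ weilClassesOf B ψ 3 d ∧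
        w' = complexBetti.map g (2 * 3) w} := by
  rw [weilClassesOf_eq_span_isRationalClass hw.pos hw.dim_eq hw.d_pos hw.sq_eq]
  refine Submodule.span_mono ?_
  rintro c ⟨hc, hcW⟩
  have h6 : A.dim = 6 := hw.dim_eq
  refine ⟨A, 𝟙 A.X, d, φ, c, h6, hw.d_pos, hw.sq_eq, hc, ?_, hcW, by rw [complexBetti.map_id]; rfl⟩
  rw [h6]
  exact hw.isOfHodgeType_of_mem_weilClassesOf hcW

/-- **The sum of ALL Weil planes of type `(3, ·)` lies in X1's Weil-pull-back summand.**
[cite: vanGeemen1994HodgeAV, 4.9 and 4.13] [cite: MoonenZarhin1999LowDim, §5] -/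
theorem allWeilClasses_three_le_span_weilPullbacks (A : AbelianVariety ℂ) :
    allWeilClasses A 3 ≤ Submodule.span ℂ {w' : complexBetti A.X (2 * 3) |
      ∃ (B : AbelianVariety ℂ) (g : A.X ⟶ B.X) (d : ℕ) (ψ : B ⟶ B) (w : complexBetti B.X (2 * 3)),
        B.dim = 6 ∧ 0 < d ∧ ψ ≫ ψ = -(d • 𝟙 B) ∧ IsRationalClass w ∧
        IsOfHodgeType B.dim B.X (2 * 3) 3 3 w ∧ w ∈ weilClassesOf B ψ 3 d ∧
        w' = complexBetti.map g (2 * 3) w} :=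
  iSup_le fun w ↦ weilClassesOf_three_le_span_weilPullbacks w.2

/-- **Every Weil plane of type `(2, d)` of `A` lies in X2′'s André summand** (case (i) of
`codimTwoWeilPullbacks A`: the FOURFOLD `B = A` itself, `g = 𝟙 A.X`). [cite: vanGeemen1994HodgeAV, 4.9–4.10]
[cite: Andre1992HodgeCM, Théorème] -/
theorem weilClassesOf_two_le_span_codimTwoWeilPullbacks {A : AbelianVariety ℂ} {φ : A ⟶ A} {d : ℕ}
    (hw : IsWeilType A φ 2 d) : weilClassesOf A φ 2 d ≤ Submodule.span ℂ (codimTwoWeilPullbacks A) := by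
  rw [weilClassesOf_eq_span_isRationalClass hw.pos hw.dim_eq hw.d_pos hw.sq_eq]
  refine Submodule.span_mono ?_
  rintro c ⟨hc, hcW⟩
  refine Set.mem_union_left _ ?_
  exact ⟨A, 𝟙 A.X, d, φ, c, hw.dim_eq, hw.d_pos, hw.sq_eq, hc, hw.isOfHodgeType_of_mem_weilClassesOf hcW, hcW,
    by rw [complexBetti.map_id]; rfl⟩

/-- **The sum of ALL Weil planes of type `(2, ·)` lies in X2′'s André summand.** [cite: Andre1992HodgeCM, Théorème]
[cite: vanGeemen1994HodgeAV, 4.13] -/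
theorem allWeilClasses_two_le_span_codimTwoWeilPullbacks (A : AbelianVariety ℂ) :
    allWeilClasses A 2 ≤ Submodule.span ℂ (codimTwoWeilPullbacks A) :=
  iSup_le fun w ↦ weilClassesOf_two_le_span_codimTwoWeilPullbacks w.2

/-! ## §2 The implication: (G)(A) ⟹ the X2-, X2′- and X1-clauses of `A` -/

/-- **(G) ⟹ `B² ⊗ ℂ ⊆ D² ⊗ ℂ` off dimension `4`** — in particular on every 6- and 7-fold.
[cite: vanGeemen1994HodgeAV, 4.9 and §2.4–2.5] -/
theorem codimTwo_mem_divisorClassesSpan_of_isDivisorMultiWeilGenerated {A : AbelianVariety ℂ}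
    (hA : A.dim ≠ 2 * 2) (hG : IsDivisorMultiWeilGenerated A) {c : complexBetti A.X (2 * 2)}
    (hc : IsRationalClass c) (hH : IsOfHodgeType A.dim A.X (2 * 2) 2 2 c) :
    c ∈ divisorClassesSpan A.X A.dim 2 :=
  mem_divisorClassesSpan_of_isDivisorMultiWeilGenerated_off_middle hG hA hc hH

/-- **(G)(A) ⟹ the X2-clause of `A`** (`Theses.SevenfoldWeilCensus.CodimTwoFromLowerDim` at `A`), for
`dim A ≠ 4`: the lower-dimensional summand is not even needed. [cite: MoonenZarhin1999LowDim, Thm. 0.2 and §5] -/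
theorem codimTwoFromLowerDim_clause_of_isDivisorMultiWeilGenerated {A : AbelianVariety ℂ} (hA : A.dim ≠ 2 * 2)
    (hG : IsDivisorMultiWeilGenerated A) (c : complexBetti A.X (2 * 2)) (hc : IsRationalClass c)
    (hH : IsOfHodgeType A.dim A.X (2 * 2) 2 2 c) :
    c ∈ divisorClassesSpan A.X A.dim 2 ⊔ Submodule.span ℂ (codimTwoLowerDimPullbacks A) :=
  Submodule.mem_sup_left (codimTwo_mem_divisorClassesSpan_of_isDivisorMultiWeilGenerated hA hG hc hH)

/-- **(G)(A) ⟹ the X2′-clause of `A`** (`CodimTwoFromWeilPullbacks` at `A`), in EVERY dimension (in dimension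
`4` the member's own Weil planes are André pull-backs along `𝟙`). [cite: Andre1992HodgeCM, Théorème]
[cite: MoonenZarhin1999LowDim, Thm. 0.2 (e), (f)] -/
theorem codimTwoFromWeilPullbacks_clause_of_isDivisorMultiWeilGenerated {A : AbelianVariety ℂ}
    (hG : IsDivisorMultiWeilGenerated A) (c : complexBetti A.X (2 * 2)) (hc : IsRationalClass c)
    (hH : IsOfHodgeType A.dim A.X (2 * 2) 2 2 c) :
    c ∈ divisorClassesSpan A.X A.dim 2 ⊔ Submodule.span ℂ (codimTwoLowerDimPullbacks A) ⊔
      Submodule.span ℂ (codimTwoWeilPullbacks A) := by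
  obtain ⟨x, hx, y, hy, rfl⟩ := Submodule.mem_sup.mp (hG 2 c hc hH)
  exact Submodule.add_mem _ (Submodule.mem_sup_left (Submodule.mem_sup_left hx))
    (Submodule.mem_sup_right (allWeilClasses_two_le_span_codimTwoWeilPullbacks A hy))

/-- **(G)(A) ⟹ the X1-clause of `A`** (`Theses.SevenfoldWeilCensus.CodimThreeWeilGeneration` at `A`), in EVERY
dimension: `D³` is X1's first summand and `Σ_k W_k` lies in its Weil-pull-back summand (§1); the `(2,2)·(1,1)`
and lower-dimensional summands are not needed. [cite: MoonenZarhin1999LowDim, (2.7)–(2.8) and §5]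
[cite: vanGeemen1994HodgeAV, Thm. 6.12] -/
theorem codimThreeWeilGeneration_clause_of_isDivisorMultiWeilGenerated {A : AbelianVariety ℂ}
    (hG : IsDivisorMultiWeilGenerated A) (c : complexBetti A.X (2 * 3)) (hc : IsRationalClass c)
    (hH : IsOfHodgeType A.dim A.X (2 * 3) 3 3 c) :
    c ∈ divisorClassesSpan A.X A.dim 3 ⊔ Submodule.span ℂ {w' : complexBetti A.X (2 * 3) |
          ∃ (a : complexBetti A.X (2 * 2)) (b : complexBetti A.X (2 * 1)),
            IsRationalClass a ∧ IsOfHodgeType A.dim A.X (2 * 2) 2 2 a ∧ IsRationalClass b ∧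
            IsOfHodgeType A.dim A.X (2 * 1) 1 1 b ∧ w' = cupProduct (two_mul_add_two_mul 2 1) a b} ⊔
        Submodule.span ℂ {w' : complexBetti A.X (2 * 3) |
          ∃ (C : AbelianVariety ℂ) (g : A.X ⟶ C.X) (w : complexBetti C.X (2 * 3)), C.dim < A.dim ∧
            IsRationalClass w ∧ IsOfHodgeType C.dim C.X (2 * 3) 3 3 w ∧ w' = complexBetti.map g (2 * 3) w} ⊔
        Submodule.span ℂ {w' : complexBetti A.X (2 * 3) |
          ∃ (B : AbelianVariety ℂ) (g : A.X ⟶ B.X) (d : ℕ) (ψ : B ⟶ B) (w : complexBetti B.X (2 * 3)),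
            B.dim = 6 ∧ 0 < d ∧ ψ ≫ ψ = -(d • 𝟙 B) ∧ IsRationalClass w ∧
            IsOfHodgeType B.dim B.X (2 * 3) 3 3 w ∧ w ∈ weilClassesOf B ψ 3 d ∧
            w' = complexBetti.map g (2 * 3) w} := by
  obtain ⟨x, hx, y, hy, rfl⟩ := Submodule.mem_sup.mp (hG 3 c hc hH)
  exact Submodule.add_mem _ (Submodule.mem_sup_left (Submodule.mem_sup_left (Submodule.mem_sup_left hx)))
    (Submodule.mem_sup_right (allWeilClasses_three_le_span_weilPullbacks A hy))

/-- **"(G) on every 6- and 7-fold" ⟹ X2** (route item stmt-18721, BY NAME). The hypothesis is NOT asserted — by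
§4 it inherits X2's evidence-level refutation. [cite: MoonenZarhin1999LowDim, Thm. 0.2 and §5] -/
theorem codimTwoFromLowerDim_of_forall_isDivisorMultiWeilGenerated
    (hG : ∀ A : AbelianVariety ℂ, A.dim = 6 ∨ A.dim = 7 → IsDivisorMultiWeilGenerated A) :
    SevenfoldWeilCensus.CodimTwoFromLowerDim :=
  fun A hA c hc hH ↦ codimTwoFromLowerDim_clause_of_isDivisorMultiWeilGenerated (by omega) (hG A hA) c hc hH

/-- **"(G) on every 6- and 7-fold" ⟹ X2′** (typer 1's `CodimTwoFromWeilPullbacks`, BY NAME).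
[cite: Andre1992HodgeCM, Théorème] [cite: MoonenZarhin1999LowDim, Thm. 0.2 (e), (f)] -/
theorem codimTwoFromWeilPullbacks_of_forall_isDivisorMultiWeilGenerated
    (hG : ∀ A : AbelianVariety ℂ, A.dim = 6 ∨ A.dim = 7 → IsDivisorMultiWeilGenerated A) :
    CodimTwoFromWeilPullbacks :=
  fun A hA c hc hH ↦ codimTwoFromWeilPullbacks_clause_of_isDivisorMultiWeilGenerated (hG A hA) c hc hH

/-- **"(G) on every 6- and 7-fold" ⟹ X1** (route item stmt-18720, BY NAME).
[cite: MoonenZarhin1999LowDim, (2.7)–(2.8) and §5] [cite: vanGeemen1994HodgeAV, Thm. 6.12] -/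
theorem codimThreeWeilGeneration_of_forall_isDivisorMultiWeilGenerated
    (hG : ∀ A : AbelianVariety ℂ, A.dim = 6 ∨ A.dim = 7 → IsDivisorMultiWeilGenerated A) :
    SevenfoldWeilCensus.CodimThreeWeilGeneration :=
  fun A hA c hc hH ↦ codimThreeWeilGeneration_clause_of_isDivisorMultiWeilGenerated (hG A hA) c hc hH

/-- **(G) off `𝒞` ⟹ X2′ off `𝒞`** (`CodimTwoFromWeilPullbacksOff 𝒞`, BY NAME). [cite: Andre1992HodgeCM, Théorème] -/
theorem codimTwoFromWeilPullbacksOff_of_isDivisorMultiWeilGeneratedOff {𝒞 : AbelianVariety ℂ → Prop}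
    (hG : ∀ A : AbelianVariety ℂ, A.dim = 6 ∨ A.dim = 7 → ¬ 𝒞 A → IsDivisorMultiWeilGenerated A) :
    CodimTwoFromWeilPullbacksOff 𝒞 :=
  fun A hA hn c hc hH ↦ codimTwoFromWeilPullbacks_clause_of_isDivisorMultiWeilGenerated (hG A hA hn) c hc hH

/-- **(G) off `𝒞` ⟹ X2 off `𝒞`** (the hypothesis `h₃` of typer 1's `hcUpToDim_seven_of_censusOff`, verbatim).
[cite: MoonenZarhin1999LowDim, Thm. 0.2 and §5] -/
theorem codimTwoFromLowerDimOff_of_isDivisorMultiWeilGeneratedOff {𝒞 : AbelianVariety ℂ → Prop}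
    (hG : ∀ A : AbelianVariety ℂ, A.dim = 6 ∨ A.dim = 7 → ¬ 𝒞 A → IsDivisorMultiWeilGenerated A) :
    ∀ A : AbelianVariety ℂ, A.dim = 6 ∨ A.dim = 7 → ¬ 𝒞 A → ∀ c : complexBetti A.X (2 * 2),
      IsRationalClass c → IsOfHodgeType A.dim A.X (2 * 2) 2 2 c →
        c ∈ divisorClassesSpan A.X A.dim 2 ⊔ Submodule.span ℂ {w' : complexBetti A.X (2 * 2) |
          ∃ (C : AbelianVariety ℂ) (g : A.X ⟶ C.X) (w : complexBetti C.X (2 * 2)), C.dim < A.dim ∧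
            IsRationalClass w ∧ IsOfHodgeType C.dim C.X (2 * 2) 2 2 w ∧ w' = complexBetti.map g (2 * 2) w} :=
  fun A hA hn c hc hH ↦ codimTwoFromLowerDim_clause_of_isDivisorMultiWeilGenerated (by omega) (hG A hA hn) c hc hH

/-- **(G) off `𝒞` ⟹ X1 off `𝒞`** (`CodimThreeWeilGenerationOff 𝒞`, BY NAME = the hypothesis `h₂` of
`hcUpToDim_seven_of_censusOff`). [cite: MoonenZarhin1999LowDim, (2.7)–(2.8) and §5] -/
theorem codimThreeWeilGenerationOff_of_isDivisorMultiWeilGeneratedOff {𝒞 : AbelianVariety ℂ → Prop}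
    (hG : ∀ A : AbelianVariety ℂ, A.dim = 6 ∨ A.dim = 7 → ¬ 𝒞 A → IsDivisorMultiWeilGenerated A) :
    CodimThreeWeilGenerationOff 𝒞 :=
  fun A hA hn c hc hH ↦ codimThreeWeilGeneration_clause_of_isDivisorMultiWeilGenerated (hG A hA hn) c hc hH

/-! ## §3 The rows from (G) off `𝒞` — through typer 1's reduction, and sharper without the floor -/

/-- **Rows `≤ 7` from: HC on `𝒞`, (G) off `𝒞` on rows `6, 7`, `W₆` off `𝒞`, the floor** — typer 1's
`hcUpToDim_seven_of_censusOff` with its census hypotheses X2 off `𝒞`, X1 off `𝒞` DISCHARGED by (G) (§2). The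
price `CodimTwoWeilClassesCMFieldOff` of the re-target X2′ is not paid: (G) gives X2 itself.
[cite: MoonenZarhin1999LowDim, (2.7)–(2.8) and §5] [cite: Markman2025SecantWeil, Thm. 1.5.1] -/
theorem hcUpToDim_seven_of_hcOnClass_of_isDivisorMultiWeilGeneratedOff {𝒞 : AbelianVariety ℂ → Prop}
    (h𝒞 : HCOnClass 𝒞) (hG : ∀ A : AbelianVariety ℂ, A.dim = 6 ∨ A.dim = 7 → ¬ 𝒞 A → IsDivisorMultiWeilGenerated A)
    (h₄ : WeilSixfoldsOff 𝒞) (h₅ : HCUpToDim 5) : HCUpToDim 7 :=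
  hcUpToDim_seven_of_censusOff h𝒞 (codimTwoFromLowerDimOff_of_isDivisorMultiWeilGeneratedOff hG)
    (codimThreeWeilGenerationOff_of_isDivisorMultiWeilGeneratedOff hG) h₄ h₅

/-- **EXACTNESS through the reduction**: modulo {HC on `𝒞`, (G) off `𝒞` on rows `6, 7`, floor}, rows `≤ 7` are
EXACTLY `W₆` off `𝒞` (`→` on path). [cite: Markman2025SecantWeil, Thm. 1.5.1] [cite: MoonenZarhin1999LowDim, §5] -/
theorem hcUpToDim_seven_iff_weilSixfoldsOff_of_hcOnClass_of_isDivisorMultiWeilGeneratedOff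
    {𝒞 : AbelianVariety ℂ → Prop} (h𝒞 : HCOnClass 𝒞)
    (hG : ∀ A : AbelianVariety ℂ, A.dim = 6 ∨ A.dim = 7 → ¬ 𝒞 A → IsDivisorMultiWeilGenerated A)
    (h₅ : HCUpToDim 5) : HCUpToDim 7 ↔ WeilSixfoldsOff 𝒞 :=
  hcUpToDim_seven_iff_weilSixfoldsOff_of_censusOff h𝒞 (codimTwoFromLowerDimOff_of_isDivisorMultiWeilGeneratedOff hG)
    (codimThreeWeilGenerationOff_of_isDivisorMultiWeilGeneratedOff hG) h₅

/-- **Odd dimension: (G)(A) ALONE gives `HC(A)`** — (G) is `B = D` there (part XIV-B (A4′)), and `B = D` gives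
the Hodge conjecture for `A` unconditionally (van Geemen §2.4, tree theorem `hodgeConjectureFor_of_isDivisorGenerated`:
Lefschetz `(1,1)` and products). No Weil input, no floor. [cite: vanGeemen1994HodgeAV, §2.4 and 4.9] -/
theorem hodgeConjectureFor_of_isDivisorMultiWeilGenerated_of_odd_dim {A : AbelianVariety ℂ} (hA : Odd A.dim)
    (hG : IsDivisorMultiWeilGenerated A) : HodgeConjectureFor A.dim A.X :=
  hodgeConjectureFor_of_isDivisorGenerated A ((isDivisorMultiWeilGenerated_iff_isDivisorGenerated_of_odd_dim hA).1 hG)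

/-- **Row `7` off `𝒞` from (G) ALONE; with HC on `𝒞`, row `7`** — no floor, no census, no Weil classes.
[cite: vanGeemen1994HodgeAV, §2.4 and 4.9] [cite: MoonenZarhin1999LowDim, (2.7)] -/
theorem hcAtDim_seven_of_hcOnClass_of_isDivisorMultiWeilGeneratedOff {𝒞 : AbelianVariety ℂ → Prop}
    (h𝒞 : HCOnClass 𝒞) (hG : ∀ A : AbelianVariety ℂ, A.dim = 7 → ¬ 𝒞 A → IsDivisorMultiWeilGenerated A) :
    HCAtDim 7 :=
  fun A (hA : A.dim = 7) ↦ by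
    by_cases hn : 𝒞 A
    · exact h𝒞 A hn
    · exact hodgeConjectureFor_of_isDivisorMultiWeilGenerated_of_odd_dim ⟨3, by omega⟩ (hG A hA hn)

/-- **A sixfold: (G)(A) and the Weil classes of `A`'s OWN Weil structures (from `W₆` off `𝒞`, at `B = A ∉ 𝒞`)
give `HC(A)`** — part XIV's engine `hodgeConjectureFor_of_isDivisorMultiWeilGenerated`; a Weil structure on a
sixfold has `p = 3`. [cite: vanGeemen1994HodgeAV, Thm. 6.12] [cite: Deligne1982HodgeCycles, §4 Prop. 4.4] -/
theorem hodgeConjectureFor_of_isDivisorMultiWeilGenerated_of_weilSixfoldsOff {𝒞 : AbelianVariety ℂ → Prop}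
    {A : AbelianVariety ℂ} (hA : A.dim = 6) (hn : ¬ 𝒞 A) (hG : IsDivisorMultiWeilGenerated A)
    (h₄ : WeilSixfoldsOff 𝒞) : HodgeConjectureFor A.dim A.X :=
  hodgeConjectureFor_of_isDivisorMultiWeilGenerated hG fun p d φ hw c hcW hc hH ↦ by
    obtain rfl : p = 3 := by have := hw.dim_eq; omega
    exact h₄ d hw.d_pos A φ hA hw.sq_eq hn c hc (by rw [hA]; exact hH) hcW

/-- **Row `6` from: HC on `𝒞`, (G) off `𝒞` in dimension `6`, `W₆` off `𝒞`** — no floor, no census.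
[cite: MoonenZarhin1999LowDim, §5] [cite: Markman2025SecantWeil, Thm. 1.5.1] -/
theorem hcAtDim_six_of_hcOnClass_of_isDivisorMultiWeilGeneratedOff {𝒞 : AbelianVariety ℂ → Prop}
    (h𝒞 : HCOnClass 𝒞) (hG : ∀ A : AbelianVariety ℂ, A.dim = 6 → ¬ 𝒞 A → IsDivisorMultiWeilGenerated A)
    (h₄ : WeilSixfoldsOff 𝒞) : HCAtDim 6 :=
  fun A (hA : A.dim = 6) ↦ by
    by_cases hn : 𝒞 A
    · exact h𝒞 A hn
    · exact hodgeConjectureFor_of_isDivisorMultiWeilGenerated_of_weilSixfoldsOff hA hn (hG A hA hn) h₄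

/-- **EXACTNESS of row `6`, floor-free: modulo {HC on `𝒞`, (G) off `𝒞` in dimension `6`},
`HCAtDim 6 ↔ W₆ off 𝒞`** (`→` on path: typer 1's `weilSixfoldsOff_of_hcAtDim_six`).
[cite: Markman2025SecantWeil, Thm. 1.5.1] [cite: MoonenZarhin1999LowDim, §5] -/
theorem hcAtDim_six_iff_weilSixfoldsOff_of_hcOnClass_of_isDivisorMultiWeilGeneratedOff
    {𝒞 : AbelianVariety ℂ → Prop} (h𝒞 : HCOnClass 𝒞)
    (hG : ∀ A : AbelianVariety ℂ, A.dim = 6 → ¬ 𝒞 A → IsDivisorMultiWeilGenerated A) :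
    HCAtDim 6 ↔ WeilSixfoldsOff 𝒞 :=
  ⟨weilSixfoldsOff_of_hcAtDim_six 𝒞, hcAtDim_six_of_hcOnClass_of_isDivisorMultiWeilGeneratedOff h𝒞 hG⟩

/-- **… and with the cell BY NAME: `HCAtDim 6 ↔ WeilSixfolds`** (stmt-2524) modulo the same.
[cite: Markman2025SecantWeil, Thm. 1.5.1] [cite: MoonenZarhin1999LowDim, §5] -/
theorem hcAtDim_six_iff_weilSixfolds_of_hcOnClass_of_isDivisorMultiWeilGeneratedOff
    {𝒞 : AbelianVariety ℂ → Prop} (h𝒞 : HCOnClass 𝒞)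
    (hG : ∀ A : AbelianVariety ℂ, A.dim = 6 → ¬ 𝒞 A → IsDivisorMultiWeilGenerated A) :
    HCAtDim 6 ↔ SevenfoldWeilCensus.WeilSixfolds :=
  ⟨weilSixfolds_of_hcAtDim_six, fun h ↦
    hcAtDim_six_of_hcOnClass_of_isDivisorMultiWeilGeneratedOff h𝒞 hG (weilSixfoldsOff_of h 𝒞)⟩

/-- **Rows `6` and `7` together, then rows `≤ 7` with the floor** — the floor enters only for the dimensions `≤ 5`
themselves (`hcUpToDim_succ_iff`), not through any census. [cite: MoonenZarhin1999LowDim, Thm. 0.2 and §5]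
[cite: Markman2025SecantWeil, Cor. 1.6.1 and Thm. 1.5.1] -/
theorem hcUpToDim_seven_of_hcOnClass_of_isDivisorMultiWeilGeneratedOff' {𝒞 : AbelianVariety ℂ → Prop}
    (h𝒞 : HCOnClass 𝒞) (hG : ∀ A : AbelianVariety ℂ, A.dim = 6 ∨ A.dim = 7 → ¬ 𝒞 A → IsDivisorMultiWeilGenerated A)
    (h₄ : WeilSixfoldsOff 𝒞) (h₅ : HCUpToDim 5) : HCUpToDim 7 :=
  (hcUpToDim_succ_iff 6).2 ⟨(hcUpToDim_succ_iff 5).2 ⟨h₅,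
      hcAtDim_six_of_hcOnClass_of_isDivisorMultiWeilGeneratedOff h𝒞 (fun A hA ↦ hG A (Or.inl hA)) h₄⟩,
    hcAtDim_seven_of_hcOnClass_of_isDivisorMultiWeilGeneratedOff h𝒞 fun A hA ↦ hG A (Or.inr hA)⟩

/-! ## §4 The obstruction to the converse, by name -/

/-- **ONE off-middle Hodge class outside `Dᵖ ⊗ ℂ` kills (G)(A).** On a 6- or 7-fold this applies in
codimension `2` (`2·2 ≠ 6, 7`): the pull-back to `X × T` of an exceptional `(2,2)` class of an abelian fourfold `X`
of Moonen–Zarhin's cases (a)–(c) ("in these cases `D²(X) ≠ B²(X)`"), the `4` exceptional classes of the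
K3-partner sixfolds `Y × Z` (atlas-2 cell `Ring2.Atlas.HodgeQuarticTypeIVFourfoldTimesCMSurface`), the CM products
`B × E′ × E″` of the X2 evidence — all recorded on items / in atlas files, none asserted here.
[cite: MoonenZarhin1999LowDim, Thm. 0.1 and the remark after it; arXiv:math/9901113 p. 1]
[cite: vanGeemen1994HodgeAV, 4.9] -/
theorem not_isDivisorMultiWeilGenerated_of_not_mem_divisorClassesSpan {A : AbelianVariety ℂ} {p : ℕ}
    (hp : A.dim ≠ 2 * p) {c : complexBetti A.X (2 * p)} (hc : IsRationalClass c)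
    (hH : IsOfHodgeType A.dim A.X (2 * p) p p c) (hn : c ∉ divisorClassesSpan A.X A.dim p) :
    ¬ IsDivisorMultiWeilGenerated A :=
  fun hG ↦ hn (mem_divisorClassesSpan_of_isDivisorMultiWeilGenerated_off_middle hG hp hc hH)

/-- **In the middle degree: ONE Hodge class outside `Dᵖ ⊗ ℂ + Σ_k W_k ⊗ ℂ` kills (G)(A)** — e.g. on a sixfold a
`(3,3)` class that is neither a polynomial in divisors nor a sum of Weil classes of `A`'s own Weil structures
(products `(2,2)·(1,1)` with an exceptional `(2,2)` factor, pull-backs from Weil sixfold QUOTIENTS of a non-simple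
`A`: X1's other summands). [cite: MoonenZarhin1999LowDim, §5] [cite: vanGeemen1994HodgeAV, Thm. 6.12] -/
theorem not_isDivisorMultiWeilGenerated_of_not_mem_sup_allWeilClasses {A : AbelianVariety ℂ} {p : ℕ}
    {c : complexBetti A.X (2 * p)} (hc : IsRationalClass c) (hH : IsOfHodgeType A.dim A.X (2 * p) p p c)
    (hn : c ∉ divisorClassesSpan A.X A.dim p ⊔ allWeilClasses A p) : ¬ IsDivisorMultiWeilGenerated A :=
  fun hG ↦ hn (hG p c hc hH)

/-- **On a 6- or 7-fold every failure of the X2-clause is a failure of (G)** (contrapositive of §2).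
[cite: MoonenZarhin1999LowDim, Thm. 0.2 and §5] -/
theorem not_isDivisorMultiWeilGenerated_of_not_codimTwo_clause {A : AbelianVariety ℂ} (hA : A.dim = 6 ∨ A.dim = 7)
    (h : ¬ ∀ c : complexBetti A.X (2 * 2), IsRationalClass c → IsOfHodgeType A.dim A.X (2 * 2) 2 2 c →
      c ∈ divisorClassesSpan A.X A.dim 2 ⊔ Submodule.span ℂ (codimTwoLowerDimPullbacks A)) :
    ¬ IsDivisorMultiWeilGenerated A :=
  fun hG ↦ h (codimTwoFromLowerDim_clause_of_isDivisorMultiWeilGenerated (by omega) hG)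

/-- **`¬ X2 ⟹ ¬ (G on every 6- or 7-fold)`**: the universal form of (G) on rows `6, 7` INHERITS X2's refutation
(recorded at evidence level on stmt-18721; a kernel refutation of X2 would refute it in the kernel by this
theorem). (G) is a MEMBER hypothesis of the Weil cells, never a row hypothesis.
[cite: MoonenZarhin1999LowDim, Thm. 0.2 and §5] -/
theorem not_forall_isDivisorMultiWeilGenerated_of_not_codimTwoFromLowerDim
    (h : ¬ SevenfoldWeilCensus.CodimTwoFromLowerDim) :
    ¬ ∀ A : AbelianVariety ℂ, A.dim = 6 ∨ A.dim = 7 → IsDivisorMultiWeilGenerated A :=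
  fun hG ↦ h (codimTwoFromLowerDim_of_forall_isDivisorMultiWeilGenerated hG)

/-! ## §5 `𝒞 = IsOfCMType ∪ 𝒦` under `HC_CM` (a binder) and a granted cell `𝒦` -/

/-- **`HC_CM` plus a granted cell `𝒦`** (`HCOnClass 𝒦`, e.g. atlas-2's VHC cells served by invariant cycles):
rows `≤ 7` from (G) off `CM ∪ 𝒦` on rows `6, 7`, `W₆` off `CM ∪ 𝒦`, the floor.
[cite: Milne1999, §7 (H)] [cite: MoonenZarhin1999LowDim, §5] [cite: Abdulali1994FamiliesAV, Lemma 6.2] -/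
theorem hcUpToDim_seven_of_hcCM_of_hcOnClass_of_isDivisorMultiWeilGeneratedOff
    (hCM : RankFourFaces.CMAbelianHodge) {𝒦 : AbelianVariety ℂ → Prop} (h𝒦 : HCOnClass 𝒦)
    (hG : ∀ A : AbelianVariety ℂ, A.dim = 6 ∨ A.dim = 7 → ¬ (IsOfCMType A ∨ 𝒦 A) → IsDivisorMultiWeilGenerated A)
    (h₄ : WeilSixfoldsOff fun A ↦ IsOfCMType A ∨ 𝒦 A) (h₅ : HCUpToDim 5) : HCUpToDim 7 :=
  hcUpToDim_seven_of_hcOnClass_of_isDivisorMultiWeilGeneratedOff' (𝒞 := fun A ↦ IsOfCMType A ∨ 𝒦 A)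
    (hcOnClass_or_iff.mpr ⟨hcOnClass_cmType_of_hcCM hCM, h𝒦⟩) hG h₄ h₅

/-- **Row `7` under `HC_CM` plus `𝒦`: (G) off `CM ∪ 𝒦` in dimension `7` suffices — no Weil input at all.**
[cite: vanGeemen1994HodgeAV, §2.4] [cite: MoonenZarhin1999LowDim, (2.7) and (3.8)] -/
theorem hcAtDim_seven_of_hcCM_of_hcOnClass_of_isDivisorMultiWeilGeneratedOff
    (hCM : RankFourFaces.CMAbelianHodge) {𝒦 : AbelianVariety ℂ → Prop} (h𝒦 : HCOnClass 𝒦)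
    (hG : ∀ A : AbelianVariety ℂ, A.dim = 7 → ¬ (IsOfCMType A ∨ 𝒦 A) → IsDivisorMultiWeilGenerated A) :
    HCAtDim 7 :=
  hcAtDim_seven_of_hcOnClass_of_isDivisorMultiWeilGeneratedOff (𝒞 := fun A ↦ IsOfCMType A ∨ 𝒦 A)
    (hcOnClass_or_iff.mpr ⟨hcOnClass_cmType_of_hcCM hCM, h𝒦⟩) hG

/-! ## §6 Audit: the HC-shaped conclusions are on path; (G), X1, X2, X2′ are not consequences of HC -/

/-- Audit: rows `6`, `7`, `≤ 7` and `W₆` off `𝒞` follow from `HodgeConjecture` (on path, typer 1's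
`hcOnClass_of_hodgeConjecture`). The generation statements (G), X1, X2, X2′ are Hodge-theoretic (about the SHAPE
of the Hodge ring), NOT consequences of `HodgeConjecture`, and are never asserted in this file. [cite: Deligne2000, §1] -/
theorem rowsSixSeven_multiWeil_audit_of_hodgeConjecture (h : _root_.HodgeConjecture) (𝒞 : AbelianVariety ℂ → Prop) :
    HCAtDim 6 ∧ HCAtDim 7 ∧ HCUpToDim 7 ∧ WeilSixfoldsOff 𝒞 :=
  ⟨hcOnClass_of_hodgeConjecture _ h, hcOnClass_of_hodgeConjecture _ h, hcOnClass_of_hodgeConjecture _ h,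
    weilSixfoldsOff_of (weilSixfolds_of_hcAtDim_six (hcOnClass_of_hodgeConjecture _ h)) 𝒞⟩

end Summit.HodgeConjecture.HodgeConjecture.Ring2.Hypotheses

end
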